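import Mathlib
import Summits.ValiantsHypothesis.ValiantsHypothesis.Theorems.BarrierLeverPartitionMinorsHitByVPHiddenStatesBlockCut
import Summits.ValiantsHypothesis.ValiantsHypothesis.Theorems.BarrierLeverPartitionMinorsHitByVPHiddenStatesLowerToAll
import Summits.ValiantsHypothesis.ValiantsHypothesis.Theorems.BarrierLeverPartitionMinorsHitByVPSimplexJoinUniformSimplex

/-!
# Route BarrierLever — item `PartitionMinorsHitByVP` (stmt-ValiantsHypothesis-19717), line `hidden_states`:
# THE PAIR-BALL PIECE — uniform as soon as the tied secant configuration has full column rank (node BP, typed)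

Helper file (`--supports stmt-ValiantsHypothesis-19717`; cell valiant-natproofs, rung V4, 𝒟-side door (c), line `hidden_states`,
node #1 `stub_universalJoinWide`; prover seat val-np-p3 gen 20; seat memo MEMO-blockpeeling-valnp3-g20 §12–§13). One bookkeeping
`structure` (a `Prop`) and one typed statement (a `Prop`, NOT asserted). Closes NO item.

THE PIECE. One piece of the wide join door that is LEGAL TODAY (node #1, no gadget): `b` CHEAP states (weight 1), `F` FREE states
(weight 2), threshold 2 — columns: the origin `∅`, the singles `{q}`, the block pairs `{q, q'}` (`q, q'` cheap) and the free singles;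
`1 + b + C(b,2) + F` columns on `K = b + F ≤ h³` states, i.e. `η ≈ 2` columns per state when `C(b,2) ≈ F`. `IsPairBall cols B` records
the shape of its zero-base part (`B` = the cheap states; sub-blocks allowed).
* `Stmt.bp2 β₁ β₂ h n` — BP, TYPED: for every pair-ball-shaped zero-base family with `n` columns, COMPLETE block on `β₁ ≤ b ≤ β₂` cheap states,
  and every injective family `ℛ` of `n` NONEMPTY subsets of `Fin h`, SOME block table gives the block columns `{k : cols k ⊆ B}` a base on
  `ℛ` (full column rank of the tied secant configuration `{g_q, g_q + g_q'}` on `V_ℛ`). Census (kit j330545, rank mod p, 12 adversarial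
  row families incl. balls, cubes, stars, random down-sets): NO defect for `b ≥ 2.5h` at `h = 8, 10, 12` even with `F = 0` (e.g. `h = 12`,
  `b = 40, 60, 89`; `4006` rows); defects for `h < b ≲ 3h` on ball-like rows (j330766: `b = 2h` defective at `h = 13–16`, `b = 3h` full at
  `h = 13–15`, `h = 16, b = 48` one defect) — the pair laws force a WINDOW; of record `h^{5/2}/7 ≲ b ≲ h³/8` (memo §13).
* `PairBall.exists_table_zero` — BP ⇒ the zero-base part is good on every injective family of nonempty rows
  (`GreedyCut.exists_table_of_block_rest` + generic points for the free singles).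
* **`PairBall.exists_table`** — BP ⇒ the piece WITH ORIGIN is UNIFORM: for EVERY injective `u` some table makes
  `[∏_{c ∈ u i} (tx none c + Σ_{q ∈ cols k} tx (some q) c)]` nonsingular (lower sets: the origin column is the unit vector of the row `∅`;
  then `LowerToAll.good_of_lower_onePiece`). With `SimplexJoin.good_of_uniform_pieces_join` + `HiddenStatesLine.stub_joinDoorWide`
  a join of `2h` such pieces serves every `(u, w)` of its size; the threshold bookkeeping of that design is not done here.
WHAT THIS IS NOT: BP is not proved; item 19717 stays OPEN; nothing on crux 14610 or VP ≠ VNP.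
-/

set_option linter.dupNamespace false

namespace Summit.ValiantsHypothesis.ValiantsHypothesis.Theorems.BarrierLever.HiddenStates

open Finset Matrix

noncomputable section

namespace PairBall

open PairBlock GreedyCut Matching

variable {h K n : ℕ}

/-- Shape of the zero-base part of a pair-ball piece with cheap states `B`: distinct columns, each a cheap single `{q}` (`q ∈ B`),
a cheap pair `{q, q'} ⊆ B`, or a free single `{f}` (`f ∉ B`). -/
structure IsPairBall (cols : Fin n → Finset (Fin K)) (B : Finset (Fin K)) : Prop where
  inj : Function.Injective cols
  shape : ∀ k, cols k ⊆ B ∧ ((cols k).card = 1 ∨ (cols k).card = 2) ∨ ∃ f, f ∉ B ∧ cols k = {f}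

/-- The block of a pair-ball family is COMPLETE: every cheap single and every cheap pair is a column. -/
def IsComplete (cols : Fin n → Finset (Fin K)) (B : Finset (Fin K)) : Prop :=
  (∀ q ∈ B, ∃ k, cols k = {q}) ∧ ∀ q ∈ B, ∀ q' ∈ B, q ≠ q' → ∃ k, cols k = {q, q'}

/-- **BP(β₁, β₂) (typed; not asserted).** For every pair-ball-shaped zero-base family with `n` columns whose block is complete on
a cheap set `B` with `β₁ ≤ |B| ≤ β₂` (any number of free states) and every injective family of `n` NONEMPTY subsets of `Fin h`, some
block table gives the block columns a base (`GreedyCut.IsBase`: full column rank of the tied secant configuration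
`{g_q, g_q + g_q'}_{q, q' ∈ B}` on `V_ℛ`). The WINDOW is essential: the pair laws of `…HiddenStatesShadowRankPairs` kill blocks with
`|B| > |B_{≤q}(h)| + √(2|B_{≤q}(h)|)` whenever all rows may have size `≤ 2q+1`, and the census (kit j330545, j330766) finds defects for
`h < |B| ≲ 3h` on ball-like rows; the window of record is `h^{5/2}/7 ≲ |B| ≲ h³/8` (memo §13). -/
def Stmt.bp2 (β₁ β₂ h n : ℕ) : Prop :=
  ∀ (K : ℕ) (cols : Fin n → Finset (Fin K)) (B : Finset (Fin K)), IsPairBall cols B → β₁ ≤ B.card → B.card ≤ β₂ →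
    IsComplete cols B →
    ∀ ℛ : Fin n → Finset (Fin h), Function.Injective ℛ → (∀ i, (ℛ i).Nonempty) →
      ∃ gB : Fin K → Fin h → ℂ, ∃ R : Finset (Fin n),
        IsBase (cfgMat ℛ cols gB) (Finset.univ.filter fun k => cols k ⊆ B) R

/-- Every column of a pair-ball family lies inside the cheap set or avoids it. -/
theorem IsPairBall.inside_or_disjoint {cols : Fin n → Finset (Fin K)} {B : Finset (Fin K)} (hP : IsPairBall cols B) (k : Fin n) :
    cols k ⊆ B ∨ Disjoint (cols k) B := by
  rcases hP.shape k with ⟨hsub, -⟩ | ⟨f, hf, hk⟩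
  · exact Or.inl hsub
  · right
    rw [hk, Finset.disjoint_singleton_left]
    exact hf

/-- A column outside the block is a free single. -/
theorem IsPairBall.eq_singleton_of_not_subset {cols : Fin n → Finset (Fin K)} {B : Finset (Fin K)} (hP : IsPairBall cols B)
    {k : Fin n} (hk : ¬ cols k ⊆ B) : ∃ f, cols k = {f} := by
  rcases hP.shape k with ⟨hsub, -⟩ | ⟨f, -, hkf⟩
  · exact absurd hsub hk
  · exact ⟨f, hkf⟩

/-- **Distinct singleton columns are good on every injective row family** (generic points,
`SimplexJoin.exists_points_det_ne_zero`). -/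
theorem exists_table_singletons {n' : ℕ} (c : Fin n' → Finset (Fin K)) (f : Fin n' → Fin K) (hc : ∀ y, c y = {f y})
    (hf : Function.Injective f) (v : Fin n' → Finset (Fin h)) (hv : Function.Injective v) :
    ∃ g : Fin K → Fin h → ℂ, (cfgMat v c g).det ≠ 0 := by
  classical
  obtain ⟨z, hz⟩ := SimplexJoin.exists_points_det_ne_zero n' h v hv
  refine ⟨fun q a => ∑ y ∈ Finset.univ.filter (fun y => f y = q), z y a, ?_⟩
  have hmat : (cfgMat v c fun q a => ∑ y ∈ Finset.univ.filter (fun y => f y = q), z y a) =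
      Matrix.of fun x x' : Fin n' => ∏ a ∈ v x, z x' a := by
    refine Matrix.ext fun x x' => ?_
    simp only [cfgMat, Matrix.of_apply, hc, Finset.sum_singleton]
    refine Finset.prod_congr rfl fun a _ => ?_
    have hfil : (Finset.univ.filter fun y => f y = f x') = {x'} := by
      ext y
      simp only [Finset.mem_filter, Finset.mem_univ, true_and, Finset.mem_singleton]
      exact ⟨fun hy => hf hy, fun hy => by rw [hy]⟩
    rw [hfil, Finset.sum_singleton]
  rw [hmat]
  exact hz

/-- **BP ⇒ the zero-base part of the pair-ball piece is good on every injective family of nonempty rows.** -/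
theorem exists_table_zero {β₁ β₂ : ℕ} (hBP : Stmt.bp2 β₁ β₂ h n) (cols : Fin n → Finset (Fin K)) (B : Finset (Fin K))
    (hP : IsPairBall cols B) (hβ : β₁ ≤ B.card) (hβ' : B.card ≤ β₂) (hC : IsComplete cols B)
    (ℛ : Fin n → Finset (Fin h)) (hℛ : Function.Injective ℛ) (hne : ∀ i, (ℛ i).Nonempty) :
    ∃ g : Fin K → Fin h → ℂ, (cfgMat ℛ cols g).det ≠ 0 := by
  classical
  set P : Finset (Fin n) := Finset.univ.filter fun k => cols k ⊆ B with hPdef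
  -- the rest: distinct free singles
  have hout : ∀ y : Fin Pᶜ.card, ∃ f, cols (Pᶜ.orderEmbOfFin rfl y) = {f} := by
    intro y
    have hy : Pᶜ.orderEmbOfFin rfl y ∉ P := Finset.mem_compl.mp (Pᶜ.orderEmbOfFin_mem rfl y)
    have hy' : ¬ cols (Pᶜ.orderEmbOfFin rfl y) ⊆ B := fun hh => hy (Finset.mem_filter.mpr ⟨Finset.mem_univ _, hh⟩)
    exact hP.eq_singleton_of_not_subset hy'
  choose f hf using hout
  have hfinj : Function.Injective f := by
    intro y y' hyy'
    have : cols (Pᶜ.orderEmbOfFin rfl y) = cols (Pᶜ.orderEmbOfFin rfl y') := by rw [hf y, hf y', hyy']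
    exact (Pᶜ.orderEmbOfFin rfl).injective (hP.inj this)
  exact exists_table_of_block_rest ℛ hℛ cols B hP.inside_or_disjoint rfl rfl (hBP K cols B hP hβ hβ' hC ℛ hℛ hne)
    (fun v hv => exists_table_singletons _ f hf hfinj v hv)

/-- A lower-set range of a nonempty injective family contains the empty set. -/
theorem exists_eq_empty_of_isLowerSet (v : Fin (n + 1) → Finset (Fin h)) (hlow : IsLowerSet (Set.range v)) :
    ∃ i₀, v i₀ = ∅ := by
  have h0 : (∅ : Finset (Fin h)) ∈ Set.range v :=
    hlow (show (∅ : Finset (Fin h)) ≤ v 0 from Finset.empty_subset _) ⟨0, rfl⟩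
  obtain ⟨i₀, hi₀⟩ := h0
  exact ⟨i₀, hi₀⟩

/-- **BP ⇒ the pair-ball piece is good on lower sets** (base point `0`: the origin column is the unit vector of the row `∅`, the
minor is the zero-base part on the other — nonempty — rows). -/
theorem exists_table_lower {β₁ β₂ : ℕ} (hBP : Stmt.bp2 β₁ β₂ h n) (cols : Fin (n + 1) → Finset (Fin K)) (k₀ : Fin (n + 1))
    (hk₀ : cols k₀ = ∅) (B : Finset (Fin K)) (hP : IsPairBall (fun x : Fin n => cols (k₀.succAbove x)) B) (hβ : β₁ ≤ B.card)
    (hβ' : B.card ≤ β₂)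
    (hC : IsComplete (fun x : Fin n => cols (k₀.succAbove x)) B)
    (v : Fin (n + 1) → Finset (Fin h)) (hv : Function.Injective v) (hlow : IsLowerSet (Set.range v)) :
    ∃ tx : Option (Fin K) → Fin h → ℂ,
      (Matrix.of fun i k : Fin (n + 1) => ∏ c ∈ v i, (tx none c + ∑ q ∈ cols k, tx (some q) c)).det ≠ 0 := by
  classical
  obtain ⟨i₀, hi₀⟩ := exists_eq_empty_of_isLowerSet v hlow
  set ℛ : Fin n → Finset (Fin h) := fun x => v (i₀.succAbove x) with hℛ
  have hℛinj : Function.Injective ℛ := fun x x' hxx' => Fin.succAbove_right_injective (hv hxx')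
  have hne : ∀ x, (ℛ x).Nonempty := by
    intro x
    rw [Finset.nonempty_iff_ne_empty]
    intro hemp
    exact Fin.succAbove_ne i₀ x (hv (hemp.trans hi₀.symm))
  obtain ⟨g, hg⟩ := exists_table_zero hBP (fun x : Fin n => cols (k₀.succAbove x)) B hP hβ hβ' hC ℛ hℛinj hne
  refine ⟨fun o c => o.elim 0 (fun q => g q c), ?_⟩
  set A : Matrix (Fin (n + 1)) (Fin (n + 1)) ℂ := Matrix.of fun i k : Fin (n + 1) =>
    ∏ c ∈ v i, ((fun o c => Option.elim o (0 : ℂ) (fun q => g q c)) none c +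
      ∑ q ∈ cols k, (fun o c => Option.elim o (0 : ℂ) (fun q => g q c)) (some q) c) with hA
  have hcol : ∀ i, A i k₀ = if i = i₀ then 1 else 0 := by
    intro i
    simp only [hA, Matrix.of_apply, hk₀, Finset.sum_empty, Option.elim, add_zero]
    by_cases hi : i = i₀
    · rw [if_pos hi, hi, hi₀, Finset.prod_empty]
    · rw [if_neg hi]
      have hne' : (v i).Nonempty := by
        rw [Finset.nonempty_iff_ne_empty]
        intro hemp
        exact hi (hv (hemp.trans hi₀.symm))
      obtain ⟨c, hc⟩ := hne'
      exact Finset.prod_eq_zero hc rfl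
  have hminor : A.submatrix i₀.succAbove k₀.succAbove = cfgMat ℛ (fun x : Fin n => cols (k₀.succAbove x)) g := by
    refine Matrix.ext fun x x' => ?_
    simp [hA, cfgMat, Matrix.submatrix_apply, hℛ]
  have hdet : A.det = (-1) ^ ((i₀ : ℕ) + (k₀ : ℕ)) * (cfgMat ℛ (fun x : Fin n => cols (k₀.succAbove x)) g).det := by
    rw [Matrix.det_succ_column A k₀, Finset.sum_eq_single i₀]
    · rw [hcol, if_pos rfl, mul_one, hminor]
    · intro i _ hi
      rw [hcol, if_neg hi, mul_zero, zero_mul]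
    · intro hi
      exact absurd (Finset.mem_univ i₀) hi
  show A.det ≠ 0
  rw [hdet]
  exact mul_ne_zero (pow_ne_zero _ (by norm_num)) hg

/-- **BP ⇒ THE PAIR-BALL PIECE IS UNIFORM**: for EVERY injective row family some table makes the one-piece block-additive matrix
nonsingular (lower sets suffice, `LowerToAll.good_of_lower_onePiece`). -/
theorem exists_table {β₁ β₂ : ℕ} (hBP : Stmt.bp2 β₁ β₂ h n) (cols : Fin (n + 1) → Finset (Fin K)) (k₀ : Fin (n + 1))
    (hk₀ : cols k₀ = ∅) (B : Finset (Fin K)) (hP : IsPairBall (fun x : Fin n => cols (k₀.succAbove x)) B) (hβ : β₁ ≤ B.card)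
    (hβ' : B.card ≤ β₂)
    (hC : IsComplete (fun x : Fin n => cols (k₀.succAbove x)) B)
    (u : Fin (n + 1) → Finset (Fin h)) (hu : Function.Injective u) :
    ∃ tx : Option (Fin K) → Fin h → ℂ,
      (Matrix.of fun i k : Fin (n + 1) => ∏ c ∈ u i, (tx none c + ∑ q ∈ cols k, tx (some q) c)).det ≠ 0 :=
  LowerToAll.good_of_lower_onePiece cols (fun v hv hlow => exists_table_lower hBP cols k₀ hk₀ B hP hβ hβ' hC v hv hlow) u hu

end PairBall

end

end Summit.ValiantsHypothesis.ValiantsHypothesis.Theorems.BarrierLever.HiddenStates
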